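import Literature.Topology.FourManifolds.BandSumDetourInstance
import Literature.Topology.FourManifolds.TubeEndCharts
import Literature.Topology.FourManifolds.FlatteningChart
import Literature.Topology.FourManifolds.BandSum
import HarnessLib

/-!
# The band sum inside an end frame of a good tube is a band sum

Topic `Literature/Topology/FourManifolds`; sequel of `BandSumDetourInstance.lean` in the
decomposition of the Fox–Milnor congruence
`Literature.Topology.FourManifolds.Knot.IsConnectedSum.isConcordant` (remaining named fact
`Knot.exists_isConnectedSum_isConcordant_left`, `BandSumConcordanceCore.lean`). The periodised
detour of `BandSumDetourCurve.lean` read through an end chart of a good tube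
(`TubeEndCharts.lean`) is shown to be a **band sum** (`BandData`, `BandSum.lean`) of the end knot
(the core) and the small copy of the second summand, along the band `c ∘ B` (`B` the foliated
chart of `BandSumFoliation.lean`), with the arches of `BandSumDetour.lean` as planar arcs.
Everything here is proved:

* `BandFoliation.EndFrame η ε` — an abstract end chart `c : ℝ³ → 𝕊³ ⊆ ℝ⁴`: `C^∞`, unit norm,
  an injective immersion on `region 0 η ε` (both `c₁` and `c₂` of `TubeEndCharts.lean` are such);
  `cS` is `c` as a map into `𝕊³`.
* `ChartData.Θ_mem_Ioo`, `F_lt`, `neg_a_lt_F`, `F_mem_ball`, `B_mem_region`, `F_eq_iff`,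
  `core_eq_B`, `flat_eq_B`, `pt2_θaffInv_mem` — ranges of the chart: the angle lies in the
  tripled interval, the height in `(-a, a + 2aδ)`, the chart lands in the region as soon as the
  tripled interval lies in the arc and `2a < ε`; on the collar the height vanishes exactly on the
  left edge line and equals `a` exactly on the right edge line; core and flat points over
  `(θlo, θhi)` are chart points of the open square.
* `KnotPiece.InTube P E Kend tiny Knew` — the hypotheses: the tube fit, the three knots read
  through the frame (`Kend ∘ circlePt = c ∘ core`, `tiny ∘ circlePoint = c ∘ k`,
  `Knew ∘ circlePt = c ∘ per`), separation of the end knot from the frame over the core strip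
  (from `GoodTube.separated`) and cleanness of the small knot near the band (from the flat arc).
* `KnotPiece.InTube.preimage_left/right`, `range_diff`, `preimage_range` — the set-theoretic
  clauses of `BandData`; `injOn_band`, `injective_mfderiv_band`; `fderiv_B_edge` (the chart
  differentiated along the edge lines) and the three orientation clauses `orient_left`,
  `orient_right`, `orient_result`.
* **`KnotPiece.InTube.bandData : BandData Kend tiny Knew ∅`** (band `cS ∘ B`, collar `C.δ`,
  arcs `cLo`, `cUp`) and `isBandSum`.

## References

* R. H. Fox, J. W. Milnor, *Singularities of 2-spheres in 4-space and cobordism of knots*, Osaka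
  J. Math. 3 (1966), §1 (the consumer: a small copy of `k₂` tied into `k₁` and carried along a
  concordance). [FoxMilnor1966]
* R. E. Gompf, A. I. Stipsicz, *4-Manifolds and Kirby Calculus* (1999), §5.1 (band sums).
  [GompfStipsicz1999]

## Design notes

The configuration is abstracted over the end frame so that the same theorem serves both ends of
the concordance; the knots are parameters and all hypotheses form one `Prop`-valued structure.
No named facts, no `sorry`; `𝔼 n`, `𝕊 n` are local notation as in `Knots.lean`.
-/

open Set Function Metric
open scoped Topology ContDiff Manifold

noncomputable section

namespace Literature.Topology.FourManifolds

namespace BandFoliation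

open ChartData (e3)
open Knot.IsConicalConcordance (region isOpen_region)

attribute [local instance] fact_finrank_euclideanSpace_succ

/-- Local notation: `𝔼 n` is the model Euclidean space `EuclideanSpace ℝ (Fin n)`. -/
local notation "𝔼 " n:arg => EuclideanSpace ℝ (Fin n)
/-- Local notation for the unit sphere `𝕊 n ⊆ 𝔼 (n+1)`. -/
local notation "𝕊 " n:arg => Metric.sphere (0 : EuclideanSpace ℝ (Fin (n + 1))) 1

/-! ### End frames -/

/-- **An end frame** of angular half-width `η` and radius `ε`: a `C^∞` map `c : ℝ³ → ℝ⁴` into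
the unit sphere which is an injective immersion on the chart region
`region 0 η ε = {x | x 0 ∈ (-η, η), (x 1, x 2) ∈ ball 0 ε}` (the two end charts `c₁`, `c₂` of a good
tube, `TubeEndCharts.lean`). [folklore] -/
structure EndFrame (η ε : ℝ) where
  /-- The chart. -/
  c : 𝔼 3 → 𝔼 4
  contDiff_c : ContDiff ℝ ∞ c
  norm_c : ∀ x, ‖c x‖ = 1
  injOn_c : InjOn c (region 0 η ε)
  injective_fderiv_c : ∀ x ∈ region 0 η ε, Injective (fderiv ℝ c x)

namespace EndFrame

variable {η ε : ℝ} (E : EndFrame η ε)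

/-- The chart lands in the unit sphere. [folklore] -/
theorem mem_sphere_c (x : 𝔼 3) : E.c x ∈ sphere (0 : 𝔼 4) 1 := by simp [E.norm_c x]

/-- The chart as a map into `𝕊³`. [folklore] -/
def cS : 𝔼 3 → 𝕊 3 := Set.codRestrict E.c _ E.mem_sphere_c

/-- Values of `cS`. [folklore] -/
@[simp] theorem coe_cS (x : 𝔼 3) : ((E.cS x : 𝕊 3) : 𝔼 4) = E.c x := rfl

/-- `cS` is smooth. [folklore] -/
theorem contMDiff_cS : ContMDiff 𝓘(ℝ, 𝔼 3) (𝓡 3) ∞ E.cS := E.contDiff_c.contMDiff.codRestrict_sphere _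

/-- `cS` is injective on the region. [folklore] -/
theorem injOn_cS : InjOn E.cS (region 0 η ε) := fun x hx y hy h ↦
  E.injOn_c hx hy (by simpa using congrArg (fun p : 𝕊 3 ↦ (p : 𝔼 4)) h)

end EndFrame

/-! ### The chart of a band relative to a tube: ranges -/

namespace ChartData

variable (C : ChartData)

/-- **The `θ`-coordinate of the chart lies in the tripled interval** `(θlo - wid, θhi + wid)`.
[folklore] -/
theorem Θ_mem_Ioo (x : EuclideanSpace ℝ (Fin 2)) : C.Θ x ∈ Ioo (C.θlo - C.wid) (C.θhi + C.wid) := by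
  have h := C.clamp_spec.2.2 (x 1)
  have hs := C.slope_pos
  have hw : C.wid = C.θhi - C.θlo := rfl
  rw [ChartData.Θ, ChartData.θaff]
  have hne : (1 + 2 * C.δ) ≠ 0 := by linarith [C.δ_pos]
  have e1 : (-(1 + 3 * C.δ) + C.δ) * (C.wid / (1 + 2 * C.δ)) = -C.wid := by
    rw [show -(1 + 3 * C.δ) + C.δ = -(1 + 2 * C.δ) by ring, neg_mul, ← mul_div_assoc,
      mul_div_cancel_left₀ _ hne]
  have e2 : (2 + 3 * C.δ + C.δ) * (C.wid / (1 + 2 * C.δ)) = 2 * C.wid := by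
    rw [show 2 + 3 * C.δ + C.δ = 2 * (1 + 2 * C.δ) by ring, mul_assoc, ← mul_div_assoc,
      mul_div_cancel_left₀ _ hne]
  constructor
  · have := mul_lt_mul_of_pos_right (show -(1 + 3 * C.δ) + C.δ < C.clamp (x 1) + C.δ by linarith [h.1]) hs
    linarith
  · have := mul_lt_mul_of_pos_right (show C.clamp (x 1) + C.δ < 2 + 3 * C.δ + C.δ by linarith [h.2]) hs
    linarith

/-- `8δ ≤ 1 - q` where `q = G x / a` (the `room` hypothesis of the chart). [folklore] -/
theorem eight_δ_le (x : EuclideanSpace ℝ (Fin 2)) : 8 * C.δ ≤ 1 - C.G x / C.a := by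
  have h := C.room _ (C.Θ_mem x)
  have ha := C.a_pos
  have hG : C.G x = circLow C.mθ C.md C.r (C.Θ x) := rfl
  rw [← hG] at h
  have h1 : C.G x / C.a ≤ 1 - 8 * C.δ := by rw [div_le_iff₀ ha]; nlinarith
  linarith

/-- **The height of the chart is below `a + 2aδ`.** [folklore] -/
theorem F_lt (x : EuclideanSpace ℝ (Fin 2)) : C.F x < C.a + 2 * C.a * C.δ := by
  have ha := C.a_pos
  obtain ⟨hg, hg'⟩ := C.G_mem x
  have hpf := C.clampS_mem_polefree x (x 0)
  have hs := (C.clampS_spec.2.2 (x 0)).2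
  have h := leaf_le ha hg hg' C.δ_pos.le hpf (by linarith)
  rw [ChartData.F]
  have : 4 * C.δ * (C.a - C.G x) < 2 * C.a * C.δ := by nlinarith [C.δ_pos]
  linarith

/-- **The height of the chart is above `-a`.** [folklore] -/
theorem neg_a_lt_F (x : EuclideanSpace ℝ (Fin 2)) : -C.a < C.F x := by
  have ha := C.a_pos
  have hδ := C.δ_pos
  obtain ⟨hg, hg'⟩ := C.G_mem x
  set q := C.G x / C.a with hq
  have hq2 : 1 / 2 < q := by rw [hq, lt_div_iff₀ ha]; linarith
  have hq1 : q < 1 := by rw [hq, div_lt_one ha]; exact hg'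
  have h8 := C.eight_δ_le x
  rw [← hq] at h8
  set s := C.clampS (x 0) with hs
  have hs1 : -(2 * C.δ) < s := (C.clampS_spec.2.2 (x 0)).1
  have hden : 0 < den q s := by
    rw [den]; nlinarith
  rw [ChartData.F, leaf, ← hq, ← hs, BandFoliation.H]
  -- `a q s / den > -a` iff `q s > -den` iff `q s + (2q-1) s + 1 - q > 0`
  rw [show C.a * (q * s / den q s) = C.a * (q * s) / den q s by ring, lt_div_iff₀ hden]
  rw [den]
  have key : 0 < (3 * q - 1) * s + (1 - q) := by
    have := mul_lt_mul_of_pos_left hs1 (show (0 : ℝ) < 3 * q - 1 by linarith)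
    nlinarith
  nlinarith [mul_pos ha key]

/-- **The height of the chart lies in `(-a, 2a)`**, hence `(F x, 0)` is in the `ε`-ball as soon as
`2a < ε`. [folklore] -/
theorem F_mem_ball {ε : ℝ} (hε : 2 * C.a < ε) (x : EuclideanSpace ℝ (Fin 2)) :
    ((C.F x, (0 : ℝ)) : ℝ × ℝ) ∈ ball (0 : ℝ × ℝ) ε := by
  have h1 := C.F_lt x
  have h2 := C.neg_a_lt_F x
  have hδ := C.δ_le
  have ha := C.a_pos
  rw [mem_ball_zero_iff, Prod.norm_mk, Real.norm_eq_abs, norm_zero, max_lt_iff, abs_lt]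
  exact ⟨⟨by linarith, by nlinarith⟩, by linarith⟩

/-- **The chart maps into the chart region** of a tube whose arc `[-η/8, η/8]` contains the
tripled `θ`-interval and whose radius exceeds `2a`. [folklore] -/
theorem B_mem_region {η ε : ℝ} (hlo : -(η / 8) ≤ C.θlo - C.wid) (hhi : C.θhi + C.wid ≤ η / 8)
    (hε : 2 * C.a < ε) (x : EuclideanSpace ℝ (Fin 2)) : C.B x ∈ region 0 η ε := by
  have hΘ := C.Θ_mem_Ioo x
  have hη : 0 < η := by linarith [hΘ.1, hΘ.2]
  refine ⟨?_, ?_⟩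
  · rw [ChartData.B_apply_zero]; exact ⟨by linarith [hΘ.1], by linarith [hΘ.2]⟩
  · rw [ChartData.B_apply_one, ChartData.B_apply_two]; exact C.F_mem_ball hε x

/-- **On the open collar the height vanishes exactly on the left edge line** and equals `a`
exactly on the right edge line. [folklore] -/
theorem F_eq_iff {x : EuclideanSpace ℝ (Fin 2)} (hx : x 0 ∈ Icc (-C.δ) (1 + C.δ)) :
    (C.F x = 0 ↔ x 0 = 0) ∧ (C.F x = C.a ↔ x 0 = 1) := by
  have ha := C.a_pos
  obtain ⟨hg, hg'⟩ := C.G_mem x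
  rw [C.F_eq hx]
  have hmono := strictMonoOn_leaf ha hg hg'
  have h8 := C.eight_δ_le x
  have hpf : -(1 - C.G x / C.a) / 2 ≤ -C.δ := by linarith [C.δ_pos]
  have hmx : x 0 ∈ Ici (-(1 - C.G x / C.a) / 2) := le_trans hpf hx.1
  have hm0 : (0 : ℝ) ∈ Ici (-(1 - C.G x / C.a) / 2) := le_trans hpf (by linarith [C.δ_pos])
  have hm1 : (1 : ℝ) ∈ Ici (-(1 - C.G x / C.a) / 2) := le_trans hpf (by linarith [C.δ_pos])
  constructor
  · constructor
    · intro h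
      exact hmono.injOn hmx hm0 (by rw [leaf_zero]; exact h)
    · intro h; rw [h, leaf_zero]
  · constructor
    · intro h
      exact hmono.injOn hmx hm1 (by rw [leaf_one ha.ne' (by linarith : C.G x ≠ 0)]; exact h)
    · intro h; rw [h, leaf_one ha.ne' (by linarith : C.G x ≠ 0)]

/-- `θaffInv u` lies in the clamp identity range for `u ∈ [θlo - wid/2, θhi + wid/2]`. [folklore] -/
theorem θaffInv_mem_wide {u : ℝ} (hu : u ∈ Icc (C.θlo - C.wid / 2) (C.θhi + C.wid / 2)) :
    C.θaffInv u ∈ Icc (-(1 + 2 * C.δ)) (2 + 2 * C.δ) := by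
  have hs := C.slope_pos'
  have hδ := C.δ_pos
  have h1 : C.θaffInv u - C.θaffInv C.θlo = (u - C.θlo) / C.slope := C.θaffInv_sub _ _
  have h2 : C.θaffInv u - C.θaffInv C.θhi = (u - C.θhi) / C.slope := C.θaffInv_sub _ _
  rw [C.θaffInv_θlo] at h1; rw [C.θaffInv_θhi] at h2
  have e : (C.wid / 2) / C.slope = (1 + 2 * C.δ) / 2 := by
    rw [ChartData.slope]; have : (1 + 2 * C.δ) ≠ 0 := by linarith
    have hw : C.wid ≠ 0 := C.wid_pos.ne'
    field_simp
  have h3 : -((C.wid / 2) / C.slope) ≤ (u - C.θlo) / C.slope := by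
    rw [← neg_div]; exact div_le_div_of_nonneg_right (by linarith [hu.1]) hs.le
  have h4 : (u - C.θhi) / C.slope ≤ (C.wid / 2) / C.slope :=
    div_le_div_of_nonneg_right (by linarith [hu.2]) hs.le
  rw [e] at h3 h4
  constructor <;> linarith

/-- **Core points in the tripled interval are chart points of the left edge line**:
`u • e₀ = B (0, θaffInv u)` for `u ∈ [θlo - wid/2, θhi + wid/2]`. [folklore] -/
theorem core_eq_B {u : ℝ} (hu : u ∈ Icc (C.θlo - C.wid / 2) (C.θhi + C.wid / 2)) :
    u • e3 0 = C.B (pt2 0 (C.θaffInv u)) := by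
  rw [KnotPiece.B_pt2_zero (C.θaffInv_mem_wide hu), C.θaff_θaffInv]

/-- **Flat points in the tripled interval are chart points of the right edge line**:
`u • e₀ + a • e₁ = B (1, θaffInv u)` for `u ∈ [θlo - wid/2, θhi + wid/2]`. [folklore] -/
theorem flat_eq_B {u : ℝ} (hu : u ∈ Icc (C.θlo - C.wid / 2) (C.θhi + C.wid / 2)) :
    u • e3 0 + C.a • e3 1 = C.B (pt2 1 (C.θaffInv u)) := by
  rw [KnotPiece.B_pt2_one (C.θaffInv_mem_wide hu), C.θaff_θaffInv]

/-- The left/right edge points with `x₁ = θaffInv u`, `u ∈ (θlo, θhi)`, lie in the square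
neighbourhood. [folklore] -/
theorem pt2_θaffInv_mem {u : ℝ} (hu : u ∈ Ioo C.θlo C.θhi) {i : ℝ} (hi : i = 0 ∨ i = 1) :
    pt2 i (C.θaffInv u) ∈ squareNhd C.δ := by
  have hs := C.slope_pos'
  have hδ := C.δ_pos
  have h1 : C.θaffInv u - C.θaffInv C.θlo = (u - C.θlo) / C.slope := C.θaffInv_sub _ _
  have h2 : C.θaffInv u - C.θaffInv C.θhi = (u - C.θhi) / C.slope := C.θaffInv_sub _ _
  rw [C.θaffInv_θlo] at h1; rw [C.θaffInv_θhi] at h2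
  have h3 : 0 < (u - C.θlo) / C.slope := div_pos (by linarith [hu.1]) hs
  have h4 : (u - C.θhi) / C.slope < 0 := div_neg_of_neg_of_pos (by linarith [hu.2]) hs
  intro j; fin_cases j
  · change pt2 i (C.θaffInv u) 0 ∈ Ioo (-C.δ) (1 + C.δ)
    rcases hi with rfl | rfl <;> simp <;> constructor <;> linarith
  · change pt2 i (C.θaffInv u) 1 ∈ Ioo (-C.δ) (1 + C.δ)
    simp; constructor <;> linarith

end ChartData

/-! ### A band sum read in an end frame: the hypotheses -/

namespace KnotPiece

variable {C : ChartData} {D : SegData C} (P : KnotPiece C D)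

/-- **The band-sum configuration inside an end frame.** The chart `C`, the small knot `P.k` and
the glued curve fit in the tube (`TubeFit`, with the *tripled* `θ`-interval inside the arc
`[-η/8, η/8]`); the three knots `Kend` (the end knot: the core), `tiny` (the small copy of the
second summand) and `Knew` (the band sum: the periodised detour) are read through the frame `c`;
the end knot meets the frame over the core strip only along the core, with matching parameters
(`separated`, from `GoodTube.separated`); and the small knot is *clean near the band*: a point of
`k` whose `θ`-coordinate lies in the tripled interval and whose height is below `a + 2aδ` is a
point of the flat part (`clean`, from the flat arc of `KnotFlatArc.lean`). [folklore] -/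
structure InTube {η ε : ℝ} (E : EndFrame η ε) (Kend tiny Knew : Knot) : Prop where
  fit : P.TubeFit η ε
  lo3 : -(η / 8) ≤ C.θlo - C.wid
  hi3 : C.θhi + C.wid ≤ η / 8
  hKend : ∀ u, ((Kend (circlePt u) : 𝕊 3) : 𝔼 4) = E.c (core u)
  htiny : ∀ θ, ((tiny (circlePoint θ) : 𝕊 3) : 𝔼 4) = E.c (P.k θ)
  hKnew : ∀ u, ((Knew (circlePt u) : 𝕊 3) : 𝔼 4) = E.c (P.per u)
  separated : ∀ x : 𝔼 3, x 0 ∈ Icc (-(η / 4)) (η / 4) → ((x 1, x 2) : ℝ × ℝ) ∈ ball (0 : ℝ × ℝ) ε →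
    ∀ u, E.c x = ((Kend (circlePt u) : 𝕊 3) : 𝔼 4) → x 1 = 0 ∧ x 2 = 0 ∧ ∃ m : ℤ, u = x 0 + m
  clean : ∀ θ, P.k θ 0 ∈ Ioo (C.θlo - C.wid) (C.θhi + C.wid) → P.k θ 1 < C.a + 2 * C.a * C.δ →
    ∃ θ' ∈ Icc D.α D.β, ∃ m : ℤ, θ = θ' + m * (2 * Real.pi)

namespace InTube

variable {P} {η ε : ℝ} {E : EndFrame η ε} {Kend tiny Knew : Knot}

/-! ### The band -/

/-- **The band** of the configuration: the chart followed by the frame. [folklore] -/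
def band (_h : P.InTube E Kend tiny Knew) (x : 𝔼 2) : 𝕊 3 := E.cS (C.B x)

/-- Values of the band in `ℝ⁴`. [folklore] -/
@[simp] theorem coe_band (h : P.InTube E Kend tiny Knew) (x : 𝔼 2) :
    ((h.band x : 𝕊 3) : 𝔼 4) = E.c (C.B x) := rfl

/-- The band as a function is `cS ∘ B`. [folklore] -/
theorem band_eq (h : P.InTube E Kend tiny Knew) : h.band = E.cS ∘ C.B := rfl

/-- **The image of the open square** under the band. [folklore] -/
def imB (h : P.InTube E Kend tiny Knew) : Set (𝕊 3) := h.band '' squareNhd C.δ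

/-! ### Preliminaries on the chart, the window and the small knot -/

/-- Every point of the circle is `circlePt v` for some `v` in the period window. [folklore] -/
theorem exists_window (y : 𝕊 1) : ∃ v ∈ Ico (C.θlo - 1 / 2) (C.θlo + 1 / 2), y = circlePt v := by
  obtain ⟨θ, rfl⟩ := circlePoint_surjective y
  refine ⟨θ / (2 * Real.pi) - idx (C := C) (θ / (2 * Real.pi)), sub_idx_mem _, ?_⟩
  rw [circlePoint_eq_circlePt_div, show θ / (2 * Real.pi) - (idx (C := C) (θ / (2 * Real.pi)) : ℝ) =
    θ / (2 * Real.pi) + ((-idx (C := C) (θ / (2 * Real.pi)) : ℤ) : ℝ) by push_cast; ring, circlePt_add_int]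

/-- Square points are collar points. [folklore] -/
theorem sq_sub_collar {x : 𝔼 2} (hx : x ∈ squareNhd C.δ) :
    x ∈ {x : 𝔼 2 | x 0 ∈ Icc (-C.δ) (1 + C.δ) ∧ x 1 ∈ Icc (-(1 + 2 * C.δ)) (2 + 2 * C.δ)} := by
  have h0 := hx 0; have h1 := hx 1; have hδ := C.δ_pos
  exact ⟨⟨h0.1.le, h0.2.le⟩, ⟨by linarith [h1.1], by linarith [h1.2]⟩⟩

/-- The angle of a square point is `θaff (x 1) ∈ (θlo, θhi)`. [folklore] -/
theorem Θ_sq {x : 𝔼 2} (hx : x ∈ squareNhd C.δ) : C.Θ x = C.θaff (x 1) ∧ C.Θ x ∈ Ioo C.θlo C.θhi := by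
  have h1 := hx 1; have hδ := C.δ_pos; have hs := C.slope_pos
  have e : C.Θ x = C.θaff (x 1) := C.Θ_eq ⟨by linarith [h1.1], by linarith [h1.2]⟩
  refine ⟨e, ?_⟩
  rw [e, ← C.θaff_neg_δ, ← C.θaff_one_add_δ]
  unfold ChartData.θaff
  exact ⟨by nlinarith [h1.1], by nlinarith [h1.2]⟩

/-- **The lower-right corner of the band is the small-knot point `k θ^A`.** [folklore] -/
theorem B_corner_lo : C.B (pt2 1 (-C.δ)) = P.k D.θA := by
  rw [P.flat _ (Ioo_subset_Icc_self D.θA_spec.1), D.θA_spec.2,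
    B_pt2_one ⟨by linarith [C.δ_pos], by linarith [C.δ_pos]⟩, C.θaff_neg_δ]

/-- **The upper-left corner of the band is the core point over `θhi`.** [folklore] -/
theorem B_corner_up : C.B (pt2 0 (1 + C.δ)) = core C.θhi := by
  rw [B_pt2_zero ⟨by linarith [C.δ_pos], by linarith [C.δ_pos]⟩, C.θaff_one_add_δ, core]

/-- Reduction of an angle modulo `2π` into `[θ^A, θ^A + 2π)`. [folklore] -/
theorem exists_reduce (θ : ℝ) : ∃ m : ℤ, θ - m * (2 * Real.pi) ∈ Ico D.θA (D.θA + 2 * Real.pi) := by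
  have h2π : (0 : ℝ) < 2 * Real.pi := by positivity
  refine ⟨⌊(θ - D.θA) / (2 * Real.pi)⌋, ?_, ?_⟩
  · have := Int.floor_le ((θ - D.θA) / (2 * Real.pi))
    rw [le_div_iff₀ h2π] at this; linarith
  · have := Int.lt_floor_add_one ((θ - D.θA) / (2 * Real.pi))
    rw [div_lt_iff₀ h2π] at this; linarith

/-- **A small-knot point of the middle parameter range is a point of the glued curve.** For
`θ ∈ [θ^A, θ^D + 2π]` there is `u ∈ [uA, uD]` with `k θ = curve u`. [folklore] -/
theorem exists_curve_eq_k {θ : ℝ} (hθ : θ ∈ Icc D.θA (D.θD + 2 * Real.pi)) :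
    ∃ u ∈ Icc D.uA D.uD, P.k θ = P.curve u := by
  have hc := D.c₁_pos
  obtain ⟨m1, m2, m3⟩ := marks (D := D)
  have hA : D.θhat D.uA = D.θA := by rw [D.θhat_of_le (by linarith)]; ring
  have hDv : D.θhat D.uD = D.θD + 2 * Real.pi := by rw [D.θhat_of_ge (by linarith)]; ring
  have hivt := intermediate_value_Icc (show D.uA ≤ D.uD by linarith) D.contDiff_θhat.continuous.continuousOn
  rw [hA, hDv] at hivt
  obtain ⟨u, hu, hθu⟩ := hivt hθ
  refine ⟨u, hu, ?_⟩
  rcases lt_or_eq_of_le hu.1 with h1 | h1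
  · rw [P.curve_of_mem_mid ⟨h1, hu.2⟩, pMid, hθu]
  · rw [← h1, P.curve_of_mem_lo ⟨m1, le_rfl⟩, P.pLo_eq_pMid ⟨by rw [uA_def]; linarith, by rw [uA_def]; linarith⟩,
      pMid, h1, hθu]

/-- **A small-knot point of the complementary range is a band point of the right edge line.** For
`θ ∈ (θ^D, θ^A)`, `k θ = B (1, θaffInv (S θ))` with the chart point in the open square. [folklore] -/
theorem k_eq_B_of_mem {θ : ℝ} (hθ : θ ∈ Ioo D.θD D.θA) :
    P.k θ = C.B (pt2 1 (C.θaffInv (D.S θ))) ∧ pt2 1 (C.θaffInv (D.S θ)) ∈ squareNhd C.δ := by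
  have hA := D.θA_spec; have hD := D.θD_spec
  have hθw : θ ∈ Icc D.α D.β := ⟨by linarith [hD.1.1, hθ.1], by linarith [hA.1.2, hθ.2]⟩
  have hS : D.S θ ∈ Ioo C.θlo C.θhi := by
    constructor
    · rw [← hA.2]; exact D.strictAntiOn_S hθw (Ioo_subset_Icc_self hA.1) hθ.2
    · rw [← hD.2]; exact D.strictAntiOn_S (Ioo_subset_Icc_self hD.1) hθw hθ.1
  refine ⟨?_, C.pt2_θaffInv_mem hS (Or.inr rfl)⟩
  rw [P.flat θ hθw, C.flat_eq_B ⟨by linarith [hS.1, C.wid_pos], by linarith [hS.2, C.wid_pos]⟩]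

variable (h : P.InTube E Kend tiny Knew)
include h

/-! ### Sizes -/

/-- `0 < η`. [folklore] -/
theorem η_pos : 0 < η := h.fit.η_pos

/-- The band width is at most `1/4`. [folklore] -/
theorem wid_le : C.wid ≤ 1 / 4 := by
  have := h.fit.lo; have := h.fit.hi; have := h.fit.η_le; rw [ChartData.wid]; linarith

/-- The chart maps into the region of the frame. [folklore] -/
theorem B_mem (x : 𝔼 2) : C.B x ∈ region 0 η ε := C.B_mem_region h.lo3 h.hi3 h.fit.two_a_lt x

/-- The chart maps into the core strip: `B x 0 ∈ [-η/4, η/4]`. [folklore] -/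
theorem B_zero_mem_strip (x : 𝔼 2) : C.B x 0 ∈ Icc (-(η / 4)) (η / 4) := by
  have hΘ := C.Θ_mem_Ioo x; have h1 := h.lo3; have h2 := h.hi3; have hη := h.fit.η_pos
  rw [ChartData.B_apply_zero]; exact ⟨by linarith [hΘ.1], by linarith [hΘ.2]⟩

/-- The normal coordinates of a chart point lie in the `ε`-ball. [folklore] -/
theorem B_d_mem (x : 𝔼 2) : ((C.B x 1, C.B x 2) : ℝ × ℝ) ∈ ball (0 : ℝ × ℝ) ε := by
  rw [ChartData.B_apply_one, ChartData.B_apply_two]; exact C.F_mem_ball h.fit.two_a_lt x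

/-- The small knot lies in the region of the frame. [folklore] -/
theorem k_mem (θ : ℝ) : P.k θ ∈ region 0 η ε := by
  have h0 := h.fit.kθ θ; have hη := h.fit.η_pos
  exact ⟨⟨by linarith [h0.1], by linarith [h0.2]⟩, h.fit.kd θ⟩

/-- `uA` lies in the window. [folklore] -/
theorem uA_mem_window : D.uA ∈ Ico (C.θlo - 1 / 2) (C.θlo + 1 / 2) := by
  obtain ⟨m1, m2, m3⟩ := marks (D := D); have := h.wid_le; rw [ChartData.wid] at this
  exact ⟨by linarith, by linarith [D.c₁_pos]⟩

/-- Points of `[θlo, θhi]` are in the window. [folklore] -/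
theorem mem_window {v : ℝ} (hv : v ∈ Icc C.θlo C.θhi) : v ∈ Ico (C.θlo - 1 / 2) (C.θlo + 1 / 2) := by
  have := h.wid_le; rw [ChartData.wid] at this
  exact ⟨by linarith [hv.1], by linarith [hv.2]⟩

/-! ### The three knots in the frame -/

/-- The end knot at `circlePt u` is the frame image of the core point. [folklore] -/
theorem Kend_eq (u : ℝ) : Kend (circlePt u) = E.cS (core u) := Subtype.ext (h.hKend u)

/-- The small knot at `circlePoint θ` is the frame image of `k θ`. [folklore] -/
theorem tiny_eq (θ : ℝ) : tiny (circlePoint θ) = E.cS (P.k θ) := Subtype.ext (h.htiny θ)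

/-- The new knot at `circlePt u` is the frame image of `per u`. [folklore] -/
theorem Knew_eq (u : ℝ) : Knew (circlePt u) = E.cS (P.per u) := Subtype.ext (h.hKnew u)

/-- In the window the new knot reads the glued curve. [folklore] -/
theorem Knew_eq_curve {v : ℝ} (hv : v ∈ Ico (C.θlo - 1 / 2) (C.θlo + 1 / 2)) :
    Knew (circlePt v) = E.cS (P.curve v) := by rw [h.Knew_eq, P.per_eq_curve hv]

/-- Off `(θlo, θhi)` (in the window) the new knot is the end knot. [folklore] -/
theorem Knew_eq_Kend {v : ℝ} (hv : v ∈ Ico (C.θlo - 1 / 2) (C.θlo + 1 / 2)) (hv' : v ∉ Ioo C.θlo C.θhi) :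
    Knew (circlePt v) = Kend (circlePt v) := by rw [h.Knew_eq_curve hv, P.curve_eq_core hv', h.Kend_eq]

/-- A band point lies in the band image of the square. [folklore] -/
theorem mem_imB {x : 𝔼 2} (hx : x ∈ squareNhd C.δ) : h.band x ∈ h.imB := ⟨x, hx, rfl⟩

/-- **Frame values determine chart points**: `c (B x) = c (B x')` for collar points forces
`x = x'`. [folklore] -/
theorem eq_of_band_eq {x x' : 𝔼 2}
    (hx : x ∈ {x : 𝔼 2 | x 0 ∈ Icc (-C.δ) (1 + C.δ) ∧ x 1 ∈ Icc (-(1 + 2 * C.δ)) (2 + 2 * C.δ)})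
    (hx' : x' ∈ {x : 𝔼 2 | x 0 ∈ Icc (-C.δ) (1 + C.δ) ∧ x 1 ∈ Icc (-(1 + 2 * C.δ)) (2 + 2 * C.δ)})
    (he : E.c (C.B x) = E.c (C.B x')) : x = x' :=
  C.injOn_B hx hx' (E.injOn_c (h.B_mem x) (h.B_mem x') he)

/-! ### The left edge: the end knot -/

/-- A chart point on the end knot is on the core line, with the same angle. [folklore] -/
theorem F_eq_zero_of_eq_Kend {x : 𝔼 2} {u : ℝ} (he : E.c (C.B x) = ((Kend (circlePt u) : 𝕊 3) : 𝔼 4)) :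
    C.F x = 0 ∧ ∃ m : ℤ, u = C.Θ x + m := by
  obtain ⟨h1, -, m, hm⟩ := h.separated (C.B x) (h.B_zero_mem_strip x) (h.B_d_mem x) u he
  rw [ChartData.B_apply_one] at h1; rw [ChartData.B_apply_zero] at hm
  exact ⟨h1, m, hm⟩

/-- **The end knot meets the band exactly in the left edge line.** [folklore] -/
theorem preimage_left : h.band ⁻¹' range Kend ∩ squareNhd C.δ = {x ∈ squareNhd C.δ | x 0 = 0} := by
  ext x
  constructor
  · rintro ⟨⟨y, hy⟩, hx⟩
    obtain ⟨u, -, rfl⟩ := exists_window (C := C) y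
    have he : E.c (C.B x) = ((Kend (circlePt u) : 𝕊 3) : 𝔼 4) := by rw [hy]; rfl
    have hF := (h.F_eq_zero_of_eq_Kend he).1
    exact ⟨hx, ((C.F_eq_iff ⟨(hx 0).1.le, (hx 0).2.le⟩).1).1 hF⟩
  · rintro ⟨hx, hx0⟩
    refine ⟨⟨circlePt (C.Θ x), ?_⟩, hx⟩
    rw [h.Kend_eq]
    show E.cS (core (C.Θ x)) = E.cS (C.B x)
    rw [ChartData.B, C.F_of_zero hx0, zero_smul, add_zero, core]

/-! ### The right edge: the small knot -/

/-- **A point of the small knot which is a chart point is a flat point at height `a`.** [folklore] -/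
theorem k_eq_of_eq_B {θ : ℝ} {x : 𝔼 2} (he : C.B x = P.k θ) :
    ∃ θ' ∈ Icc D.α D.β, P.k θ = P.k θ' ∧ P.k θ = D.S θ' • e3 0 + C.a • e3 1 ∧ C.F x = C.a := by
  have h0 : P.k θ 0 ∈ Ioo (C.θlo - C.wid) (C.θhi + C.wid) := by
    rw [← he, ChartData.B_apply_zero]; exact C.Θ_mem_Ioo x
  have h1 : P.k θ 1 < C.a + 2 * C.a * C.δ := by rw [← he, ChartData.B_apply_one]; exact C.F_lt x
  obtain ⟨θ', hθ', m, hm⟩ := h.clean θ h0 h1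
  have hper : P.k θ = P.k θ' := by
    rw [hm]; exact (P.periodic_k.int_mul m) θ'
  have hflat := P.flat θ' hθ'
  refine ⟨θ', hθ', hper, by rw [hper, hflat], ?_⟩
  have := congrArg (fun q : 𝔼 3 ↦ q 1) he
  simp only [ChartData.B_apply_one] at this
  rw [this, hper, hflat]; simp [ChartData.e3]

/-- **The small knot meets the band exactly in the right edge line.** [folklore] -/
theorem preimage_right : h.band ⁻¹' range tiny ∩ squareNhd C.δ = {x ∈ squareNhd C.δ | x 0 = 1} := by
  ext x
  constructor
  · rintro ⟨⟨y, hy⟩, hx⟩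
    obtain ⟨θ, rfl⟩ := circlePoint_surjective y
    rw [h.tiny_eq] at hy
    have he : C.B x = P.k θ :=
      E.injOn_c (h.B_mem x) (h.k_mem θ) (by simpa using (congrArg (fun p : 𝕊 3 ↦ (p : 𝔼 4)) hy).symm)
    obtain ⟨θ', -, -, -, hF⟩ := h.k_eq_of_eq_B he
    exact ⟨hx, ((C.F_eq_iff ⟨(hx 0).1.le, (hx 0).2.le⟩).2).1 hF⟩
  · rintro ⟨hx, hx0⟩
    obtain ⟨hΘ, hΘm⟩ := Θ_sq hx
    obtain ⟨t, ht, hts⟩ := D.exists_S_eq (θ₀ := C.Θ x)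
      ⟨by linarith [hΘm.1, C.wid_pos], by linarith [hΘm.2, C.wid_pos]⟩
    refine ⟨⟨circlePoint t, ?_⟩, hx⟩
    rw [h.tiny_eq]
    show E.cS (P.k t) = E.cS (C.B x)
    rw [P.flat t (Ioo_subset_Icc_self ht), hts, ChartData.B, C.F_of_one hx0]

/-! ### Outside the band: the new knot is the union of the old ones -/

/-- **Outside the band the new knot is contained in the old ones.** [folklore] -/
theorem range_Knew_diff_sub : range Knew \ h.imB ⊆ (range Kend ∪ range tiny) \ h.imB := by
  rintro z ⟨⟨y, rfl⟩, hz⟩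
  refine ⟨?_, hz⟩
  obtain ⟨v, hv, rfl⟩ := exists_window (C := C) y
  have hc := D.c₁_pos
  obtain ⟨m1, m2, m3⟩ := marks (D := D)
  by_cases hvI : v ∈ Ioo C.θlo C.θhi
  swap
  · exact Or.inl ⟨circlePt v, (h.Knew_eq_Kend hv hvI).symm⟩
  rw [h.Knew_eq_curve hv]
  rcases le_or_gt v D.uA with h2 | h2
  · -- lower arch: interior points are band points, the end point is `k θ^A`
    rw [P.curve_of_mem_lo ⟨hvI.1, h2⟩]
    rcases lt_or_eq_of_le h2 with h2 | h2
    · exfalso; apply hz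
      rw [h.Knew_eq_curve hv, P.curve_of_mem_lo ⟨hvI.1, h2.le⟩]
      refine h.mem_imB (D.cLo_mem ⟨div_pos (sub_pos.2 hvI.1) hc, ?_⟩).1
      rw [div_lt_one hc]; rw [uA_def] at h2; linarith
    · refine Or.inr ⟨circlePoint D.θA, ?_⟩
      rw [h.tiny_eq, pLo, h2, uA_def, show (C.θlo + D.c₁ - C.θlo) / D.c₁ = 1 by
        rw [add_sub_cancel_left, div_self hc.ne'], D.cLo_one, B_corner_lo]
  rcases le_or_gt v D.uD with h3 | h3
  · rw [P.curve_of_mem_mid ⟨h2, h3⟩]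
    exact Or.inr ⟨circlePoint (D.θhat v), by rw [h.tiny_eq]; rfl⟩
  · -- upper arch: interior points are band points (`v < θhi`)
    exfalso; apply hz
    rw [h.Knew_eq_curve hv, P.curve_of_mem_up ⟨h3, hvI.2.le⟩]
    refine h.mem_imB (D.cUp_mem ⟨div_pos (sub_pos.2 h3) hc, ?_⟩).1
    rw [div_lt_one hc, uD_def]; linarith [hvI.2]

/-- **Outside the band the old knots are contained in the new one.** [folklore] -/
theorem range_union_diff_sub : (range Kend ∪ range tiny) \ h.imB ⊆ range Knew \ h.imB := by
  rintro z ⟨hz, hzB⟩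
  refine ⟨?_, hzB⟩
  rcases hz with ⟨y, rfl⟩ | ⟨y, rfl⟩
  · -- a point of the end knot
    obtain ⟨v, hv, rfl⟩ := exists_window (C := C) y
    by_cases hvI : v ∈ Ioo C.θlo C.θhi
    · exfalso; apply hzB
      rw [h.Kend_eq, core, C.core_eq_B ⟨by linarith [hvI.1, C.wid_pos], by linarith [hvI.2, C.wid_pos]⟩]
      exact h.mem_imB (C.pt2_θaffInv_mem hvI (Or.inl rfl))
    · exact ⟨circlePt v, h.Knew_eq_Kend hv hvI⟩
  · -- a point of the small knot
    obtain ⟨θ, rfl⟩ := circlePoint_surjective y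
    obtain ⟨m, hm⟩ := exists_reduce (D := D) θ
    set θr := θ - m * (2 * Real.pi) with hθr
    have hper : P.k θ = P.k θr := by
      rw [show θ = θr + m * (2 * Real.pi) by rw [hθr]; ring]; exact (P.periodic_k.int_mul m) θr
    rcases le_or_gt θr (D.θD + 2 * Real.pi) with h1 | h1
    · obtain ⟨u, hu, hku⟩ := exists_curve_eq_k (P := P) ⟨hm.1, h1⟩
      obtain ⟨m1, m2, m3⟩ := marks (D := D)
      refine ⟨circlePt u, ?_⟩
      rw [h.Knew_eq_curve (h.mem_window ⟨by linarith [hu.1], by linarith [hu.2]⟩), ← hku, ← hper, h.tiny_eq]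
    · exfalso; apply hzB
      have hmem : θr - 2 * Real.pi ∈ Ioo D.θD D.θA := ⟨by linarith, by linarith [hm.2]⟩
      obtain ⟨hk, hsq⟩ := k_eq_B_of_mem (P := P) hmem
      have hper' : P.k θr = P.k (θr - 2 * Real.pi) := by
        conv_lhs => rw [← sub_add_cancel θr (2 * Real.pi)]
        exact P.periodic_k _
      rw [h.tiny_eq, hper, hper', hk]
      exact h.mem_imB hsq

/-- **Outside the band, the new knot is the union of the end knot and the small knot.** [folklore] -/
theorem range_diff : range Knew \ h.imB = (range Kend ∪ range tiny) \ h.imB :=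
  (h.range_Knew_diff_sub).antisymm h.range_union_diff_sub

/-! ### Inside the band: the two arcs -/

/-- **Inside the band the new knot is exactly the two open arcs.** [folklore] -/
theorem preimage_range :
    h.band ⁻¹' range Knew ∩ squareNhd C.δ = D.cLo '' Ioo 0 1 ∪ D.cUp '' Ioo 0 1 := by
  have hc := D.c₁_pos
  obtain ⟨m1, m2, m3⟩ := marks (D := D)
  have hwid := h.wid_le; rw [ChartData.wid] at hwid
  ext x
  constructor
  · rintro ⟨⟨y, hy⟩, hx⟩
    obtain ⟨v, hv, rfl⟩ := exists_window (C := C) y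
    have hxc := sq_sub_collar hx
    obtain ⟨hΘ, hΘm⟩ := Θ_sq hx
    by_cases hvI : v ∈ Ioo C.θlo C.θhi
    swap
    · -- off the arc: the new knot is the end knot, which meets the band only in the core with the
      -- same angle up to a nonzero period: impossible in the window
      exfalso
      rw [h.Knew_eq_Kend hv hvI] at hy
      obtain ⟨-, m, hm⟩ := h.F_eq_zero_of_eq_Kend (x := x) (u := v) (by rw [hy]; rfl)
      rw [mem_Ioo, not_and_or, not_lt, not_lt] at hvI
      have hm0 : m = 0 := by
        have h1 : (m : ℝ) < 1 := by
          by_contra hge; push Not at hge; linarith [hv.2, hΘm.1]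
        have h2 : (-1 : ℝ) < m := by
          by_contra hle; push Not at hle; linarith [hv.1, hΘm.2]
        have : (-1 : ℤ) < m := by exact_mod_cast h2
        have : m < (1 : ℤ) := by exact_mod_cast h1
        omega
      rw [hm0, Int.cast_zero, add_zero] at hm
      rcases hvI with h1 | h1
      · linarith [hΘm.1]
      · linarith [hΘm.2]
    rw [h.Knew_eq_curve hv] at hy
    have he : E.c (C.B x) = E.c (P.curve v) := by simpa using congrArg (fun p : 𝕊 3 ↦ (p : 𝔼 4)) hy.symm
    rcases le_or_gt v D.uA with h2 | h2
    · -- lower arch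
      rw [P.curve_of_mem_lo ⟨hvI.1, h2⟩, pLo] at he
      set t := (v - C.θlo) / D.c₁ with ht
      have htm : t ∈ Ioc (0 : ℝ) 1 :=
        ⟨div_pos (sub_pos.2 hvI.1) hc, by rw [ht, div_le_one hc]; rw [uA_def] at h2; linarith⟩
      have hxe : x = D.cLo t := h.eq_of_band_eq hxc (cLo_mem_collar htm) he
      rcases lt_or_eq_of_le htm.2 with h3 | h3
      · exact Or.inl ⟨t, ⟨htm.1, h3⟩, hxe.symm⟩
      · exfalso
        have := hx 1; rw [hxe, h3, D.cLo_one] at this; simp at this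
    rcases le_or_gt v D.uD with h3 | h3
    · -- middle: impossible (clean small knot; the flat part over the band is the removed arc)
      exfalso
      rw [P.curve_of_mem_mid ⟨h2, h3⟩, pMid] at he
      have heB : C.B x = P.k (D.θhat v) := E.injOn_c (h.B_mem x) (h.k_mem _) he
      obtain ⟨θ', hθ', hkk, hflat, -⟩ := h.k_eq_of_eq_B heB
      -- `S θ' = Θ x ∈ (θlo, θhi)` forces `θ' ∈ (θD, θA)`
      have hS : D.S θ' = C.Θ x := by
        have := congrArg (fun q : 𝔼 3 ↦ q 0) heB
        simp only [ChartData.B_apply_zero] at this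
        rw [this, hflat]; simp [ChartData.e3]
      have hA := D.θA_spec; have hD := D.θD_spec
      have hθ'A : θ' < D.θA := by
        by_contra hge; push Not at hge
        have := D.strictAntiOn_S.antitoneOn (Ioo_subset_Icc_self hA.1) hθ' hge
        rw [hA.2, hS] at this; linarith [hΘm.1]
      have hθ'D : D.θD < θ' := by
        by_contra hle; push Not at hle
        have := D.strictAntiOn_S.antitoneOn hθ' (Ioo_subset_Icc_self hD.1) hle
        rw [hD.2, hS] at this; linarith [hΘm.2]
      -- `θ̂ v ∈ (θA, θD + 2π]` is congruent to `θ'`: impossible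
      obtain ⟨m, hm⟩ := P.k_inj _ _ hkk
      have hlo : D.θA < D.θhat v := by
        have := D.strictMono_θhat h2
        rwa [D.θhat_of_le (u := D.uA) (by linarith), sub_self, mul_zero, add_zero] at this
      have hhi : D.θhat v ≤ D.θD + 2 * Real.pi := by
        have := D.strictMono_θhat.monotone h3
        rwa [D.θhat_of_ge (u := D.uD) (by linarith), sub_self, mul_zero, add_zero] at this
      have h2π : (0 : ℝ) < 2 * Real.pi := by positivity
      have hm1 : (m : ℝ) < 0 := by
        by_contra hge; push Not at hge
        have : (0 : ℝ) ≤ m * (2 * Real.pi) := mul_nonneg hge h2π.le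
        linarith
      have hm2 : (-1 : ℝ) < m := by
        by_contra hle; push Not at hle
        have : m * (2 * Real.pi) ≤ -1 * (2 * Real.pi) := mul_le_mul_of_nonneg_right hle h2π.le
        linarith
      have : m < (0 : ℤ) := by exact_mod_cast hm1
      have : (-1 : ℤ) < m := by exact_mod_cast hm2
      omega
    · -- upper arch (`v < θhi`)
      rw [P.curve_of_mem_up ⟨h3, hvI.2.le⟩, pUp] at he
      set t := (v - D.uD) / D.c₁ with ht
      have htm : t ∈ Ioo (0 : ℝ) 1 :=
        ⟨div_pos (sub_pos.2 h3) hc, by rw [ht, div_lt_one hc, uD_def]; linarith [hvI.2]⟩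
      have hxe : x = D.cUp t := h.eq_of_band_eq hxc (cUp_mem_collar ⟨htm.1, htm.2.le⟩) he
      exact Or.inr ⟨t, htm, hxe.symm⟩
  · rintro (⟨t, ht, rfl⟩ | ⟨t, ht, rfl⟩)
    · refine ⟨⟨circlePt (C.θlo + D.c₁ * t), ?_⟩, (D.cLo_mem ht).1⟩
      have hv : C.θlo + D.c₁ * t ∈ Ioc C.θlo D.uA := ⟨by nlinarith [ht.1], by rw [uA_def]; nlinarith [ht.2]⟩
      rw [h.Knew_eq_curve (h.mem_window ⟨hv.1.le, by linarith [hv.2]⟩), P.curve_of_mem_lo hv, pLo,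
        show (C.θlo + D.c₁ * t - C.θlo) / D.c₁ = t by field_simp; ring]
      rfl
    · refine ⟨⟨circlePt (D.uD + D.c₁ * t), ?_⟩, (D.cUp_mem ht).1⟩
      have hv : D.uD + D.c₁ * t ∈ Ioc D.uD C.θhi := ⟨by nlinarith [ht.1], by rw [uD_def]; nlinarith [ht.2]⟩
      rw [h.Knew_eq_curve (h.mem_window ⟨by linarith [hv.1], hv.2⟩), P.curve_of_mem_up hv, pUp,
        show (D.uD + D.c₁ * t - D.uD) / D.c₁ = t by field_simp; ring]
      rfl

/-! ### The band is an embedding of the square -/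

/-- The band is `C^∞`. [folklore] -/
theorem contMDiff_band : ContMDiff 𝓘(ℝ, 𝔼 2) (𝓡 3) ∞ h.band := E.contMDiff_cS.comp C.contDiff_B.contMDiff

/-- The band is injective on the square. [folklore] -/
theorem injOn_band : InjOn h.band (squareNhd C.δ) := fun x hx x' hx' he ↦
  h.eq_of_band_eq (sq_sub_collar hx) (sq_sub_collar hx')
    (by simpa using congrArg (fun p : 𝕊 3 ↦ (p : 𝔼 4)) he)

/-- The band read in `ℝ⁴` is `c ∘ B`, with derivative `Dc ∘ DB`. [folklore] -/
theorem fderiv_coe_band (x : 𝔼 2) :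
    fderiv ℝ (fun y ↦ ((h.band y : 𝕊 3) : 𝔼 4)) x = (fderiv ℝ E.c (C.B x)).comp (fderiv ℝ C.B x) := by
  have : (fun y ↦ ((h.band y : 𝕊 3) : 𝔼 4)) = E.c ∘ C.B := rfl
  rw [this]
  exact fderiv_comp x ((E.contDiff_c.differentiable (by simp)) _) ((C.contDiff_B.differentiable (by simp)) _)

/-- The band is an immersion on the square. [folklore] -/
theorem injective_mfderiv_band {x : 𝔼 2} (hx : x ∈ squareNhd C.δ) :
    Injective (mfderiv 𝓘(ℝ, 𝔼 2) (𝓡 3) h.band x) := by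
  refine injective_mfderiv_of_injective_fderiv_coe h.contMDiff_band ?_
  rw [h.fderiv_coe_band, ContinuousLinearMap.coe_comp]
  have h1 := hx 1; have hδ := C.δ_pos
  exact (E.injective_fderiv_c _ (h.B_mem x)).comp
    (C.injective_fderiv_B (hx 0) ⟨by linarith [h1.1], by linarith [h1.2]⟩)

/-! ### Directional derivatives of the chart along the edge lines -/

omit h in
/-- Points of the vertical line through an edge point. [folklore] -/
theorem pt2_add_smul (i x₁ r s : ℝ) : pt2 i x₁ + r • pt2 0 s = pt2 i (x₁ + r * s) := by
  ext j; fin_cases j <;> simp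

omit h in
/-- **The derivative of the chart along the edge lines**: at a point `(i, x₁)` of the left
(`i = 0`) or right (`i = 1`) edge line, `DB (0, s) = (s · slope) e₀`. [folklore] -/
theorem fderiv_B_edge {i : ℝ} (hi : i = 0 ∨ i = 1) {x₁ : ℝ} (hx₁ : x₁ ∈ Ioo (-(1 + 2 * C.δ)) (2 + 2 * C.δ))
    (s : ℝ) : fderiv ℝ C.B (pt2 i x₁) (pt2 0 s) = (s * C.slope) • e3 0 := by
  set p : 𝔼 2 := pt2 i x₁ with hp
  have hB : HasFDerivAt C.B (fderiv ℝ C.B p) p := ((C.contDiff_B.differentiable (by simp)) p).hasFDerivAt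
  have hline : HasDerivAt (fun r : ℝ ↦ p + r • pt2 0 s) (pt2 0 s) 0 := by
    simpa using ((hasDerivAt_id (0 : ℝ)).smul_const (pt2 0 s)).const_add p
  have hcomp : HasDerivAt (fun r : ℝ ↦ C.B (p + r • pt2 0 s)) (fderiv ℝ C.B p (pt2 0 s)) 0 := by
    have hB' : HasFDerivAt C.B (fderiv ℝ C.B p) ((fun r : ℝ ↦ p + r • pt2 0 s) 0) := by
      simp only [zero_smul, add_zero]; exact hB
    exact hB'.comp_hasDerivAt (0 : ℝ) hline
  -- the explicit form of the chart along the line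
  set K : 𝔼 3 := (if i = 0 then (0 : ℝ) else C.a) • e3 1 with hK
  have hev : (fun r : ℝ ↦ C.B (p + r • pt2 0 s)) =ᶠ[𝓝 0] fun r ↦ C.θaff (x₁ + r * s) • e3 0 + K := by
    have ho : IsOpen {r : ℝ | x₁ + r * s ∈ Ioo (-(1 + 2 * C.δ)) (2 + 2 * C.δ)} :=
      isOpen_Ioo.preimage (continuous_const.add (continuous_id.mul continuous_const))
    filter_upwards [ho.mem_nhds (show (0 : ℝ) ∈ {r : ℝ | x₁ + r * s ∈ Ioo (-(1 + 2 * C.δ)) (2 + 2 * C.δ)} by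
      simpa using hx₁)] with r hr
    rw [hp, pt2_add_smul]
    rcases hi with rfl | rfl
    · rw [B_pt2_zero (Ioo_subset_Icc_self hr), hK]; simp
    · rw [B_pt2_one (Ioo_subset_Icc_self hr), hK]; simp
  have haff : HasDerivAt (fun r : ℝ ↦ C.θaff (x₁ + r * s) • e3 0 + K) ((s * C.slope) • e3 0) 0 := by
    have h1 : HasDerivAt (fun r : ℝ ↦ C.θaff (x₁ + r * s)) (s * C.slope) 0 := by
      unfold ChartData.θaff
      have := ((((hasDerivAt_id (0 : ℝ)).mul_const s).const_add x₁).add_const C.δ).mul_const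
        (C.wid / (1 + 2 * C.δ)) |>.const_add C.θlo
      refine this.congr_deriv ?_
      rw [ChartData.slope]; ring
    exact (h1.smul_const (e3 0)).add_const K
  exact (hcomp.unique (haff.congr_of_eventuallyEq hev))

/-! ### Orientation clauses -/

/-- The end knot read in `ℝ⁴` along `circlePoint`. [folklore] -/
theorem coe_Kend_circlePoint (t : ℝ) :
    ((Kend (circlePoint t) : 𝕊 3) : 𝔼 4) = E.c (core (t / (2 * Real.pi))) := by
  rw [circlePoint_eq_circlePt_div, h.hKend]

/-- The new knot read in `ℝ⁴` along `circlePoint`. [folklore] -/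
theorem coe_Knew_circlePoint (t : ℝ) :
    ((Knew (circlePoint t) : 𝕊 3) : 𝔼 4) = E.c (P.per (t / (2 * Real.pi))) := by
  rw [circlePoint_eq_circlePt_div, h.hKnew]

/-- **Orientation of the end knot along the left edge: upwards.** [folklore] -/
theorem orient_left : ∃ θ c : ℝ, 0 < c ∧ Kend (circlePoint θ) = h.band (pt2 0 2⁻¹) ∧
    deriv (fun t ↦ ((Kend (circlePoint t) : 𝕊 3) : 𝔼 4)) θ =
      c • fderiv ℝ (fun x ↦ ((h.band x : 𝕊 3) : 𝔼 4)) (pt2 0 2⁻¹) (pt2 0 1) := by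
  have hδ := C.δ_pos
  have hs := C.slope_pos'
  have h2π : (0 : ℝ) < 2 * Real.pi := by positivity
  set u := C.θaff 2⁻¹ with hu
  have hBp : C.B (pt2 0 2⁻¹) = core u := by
    rw [B_pt2_zero ⟨by linarith, by linarith⟩, core]
  refine ⟨2 * Real.pi * u, 1 / (2 * Real.pi) / C.slope, by positivity, ?_, ?_⟩
  · apply Subtype.ext
    rw [h.coe_Kend_circlePoint, mul_div_cancel_left₀ _ h2π.ne', coe_band, hBp]
  · -- the end knot is `t ↦ c (core (t / 2π))`
    have hfun : (fun t ↦ ((Kend (circlePoint t) : 𝕊 3) : 𝔼 4)) = E.c ∘ fun t ↦ core (t / (2 * Real.pi)) := by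
      funext t; exact h.coe_Kend_circlePoint t
    have hin : HasDerivAt (fun t : ℝ ↦ core (t / (2 * Real.pi))) ((1 / (2 * Real.pi)) • e3 0) (2 * Real.pi * u) := by
      have h1 : HasDerivAt (fun t : ℝ ↦ t / (2 * Real.pi)) (1 / (2 * Real.pi)) (2 * Real.pi * u) := by
        simpa using (hasDerivAt_id (2 * Real.pi * u)).div_const (2 * Real.pi)
      exact (hasDerivAt_core _).scomp _ h1
    have hc : HasFDerivAt E.c (fderiv ℝ E.c (core u))
        ((fun t : ℝ ↦ core (t / (2 * Real.pi))) (2 * Real.pi * u)) := by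
      simp only [mul_div_cancel_left₀ _ h2π.ne']; exact ((E.contDiff_c.differentiable (by simp)) _).hasFDerivAt
    rw [hfun, (hc.comp_hasDerivAt (2 * Real.pi * u) hin).deriv, h.fderiv_coe_band, ContinuousLinearMap.comp_apply,
      fderiv_B_edge (Or.inl rfl) ⟨by linarith, by linarith⟩, hBp, map_smul, map_smul, smul_smul]
    congr 1
    field_simp

/-- **Orientation of the small knot along the right edge: downwards.** [folklore] -/
theorem orient_right : ∃ θ c : ℝ, 0 < c ∧ tiny (circlePoint θ) = h.band (pt2 1 2⁻¹) ∧
    deriv (fun t ↦ ((tiny (circlePoint t) : 𝕊 3) : 𝔼 4)) θ =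
      c • fderiv ℝ (fun x ↦ ((h.band x : 𝕊 3) : 𝔼 4)) (pt2 1 2⁻¹) (pt2 0 (-1)) := by
  have hδ := C.δ_pos
  have hs := C.slope_pos'
  obtain ⟨hh1, hh2⟩ := θaff_half_mem (C := C)
  obtain ⟨θ, hθ, hθS⟩ := D.exists_S_eq (θ₀ := C.θaff (1 / 2))
    ⟨by linarith [C.wid_pos], by linarith [C.wid_pos]⟩
  have hBp : C.B (pt2 1 2⁻¹) = P.k θ := by
    rw [B_pt2_one ⟨by linarith, by linarith⟩, P.flat θ (Ioo_subset_Icc_self hθ), hθS]; norm_num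
  have hS' := D.deriv_S_neg θ (Ioo_subset_Icc_self hθ)
  refine ⟨θ, -deriv D.S θ / C.slope, div_pos (by linarith) hs, ?_, ?_⟩
  · apply Subtype.ext
    rw [h.htiny, coe_band, hBp]
  · have hfun : (fun t ↦ ((tiny (circlePoint t) : 𝕊 3) : 𝔼 4)) = E.c ∘ P.k := by
      funext t; exact h.htiny t
    -- near `θ` the small knot is the flat line
    have hev : P.k =ᶠ[𝓝 θ] fun t ↦ D.S t • e3 0 + C.a • e3 1 := by
      filter_upwards [isOpen_Ioo.mem_nhds hθ] with t ht using P.flat t (Ioo_subset_Icc_self ht)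
    have hk : HasDerivAt P.k (deriv D.S θ • e3 0) θ := by
      have h1 : HasDerivAt (fun t ↦ D.S t • e3 0 + C.a • e3 1) (deriv D.S θ • e3 0) θ :=
        (((D.contDiff_S.differentiable (by simp)) θ).hasDerivAt.smul_const (e3 0)).add_const _
      exact h1.congr_of_eventuallyEq hev
    have hc : HasFDerivAt E.c (fderiv ℝ E.c (P.k θ)) (P.k θ) := ((E.contDiff_c.differentiable (by simp)) _).hasFDerivAt
    rw [hfun, (hc.comp_hasDerivAt θ hk).deriv, h.fderiv_coe_band, ContinuousLinearMap.comp_apply,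
      fderiv_B_edge (Or.inr rfl) ⟨by linarith, by linarith⟩, hBp, map_smul, map_smul, smul_smul]
    congr 1
    field_simp

/-- **Orientation of the new knot along the lower arch: left to right.** [folklore] -/
theorem orient_result : ∃ θ c : ℝ, 0 < c ∧ Knew (circlePoint θ) = h.band (D.cLo 2⁻¹) ∧
    deriv (fun t ↦ ((Knew (circlePoint t) : 𝕊 3) : 𝔼 4)) θ =
      c • fderiv ℝ (fun x ↦ ((h.band x : 𝕊 3) : 𝔼 4)) (D.cLo 2⁻¹) (deriv D.cLo 2⁻¹) := by
  have hc₁ := D.c₁_pos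
  have h2π : (0 : ℝ) < 2 * Real.pi := by positivity
  obtain ⟨m1, m2, m3⟩ := marks (D := D)
  have hwid := h.wid_le; rw [ChartData.wid] at hwid
  set v := C.θlo + D.c₁ / 2 with hv
  have hvI : v ∈ Ioo C.θlo D.uA := ⟨by rw [hv]; linarith, by rw [hv, uA_def]; linarith⟩
  have hgv : (v - C.θlo) / D.c₁ = 2⁻¹ := by rw [hv]; field_simp; ring
  -- the new knot near `2π v` is `t ↦ c (B (cLo ((t/2π - θlo)/c₁)))`
  set g : ℝ → ℝ := fun t ↦ (t / (2 * Real.pi) - C.θlo) / D.c₁ with hg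
  have hgθ : g (2 * Real.pi * v) = 2⁻¹ := by rw [hg]; simp only; rw [mul_div_cancel_left₀ _ h2π.ne', hgv]
  have hev : (fun t ↦ ((Knew (circlePoint t) : 𝕊 3) : 𝔼 4)) =ᶠ[𝓝 (2 * Real.pi * v)]
      E.c ∘ (C.B ∘ (D.cLo ∘ g)) := by
    have ho : IsOpen {t : ℝ | t / (2 * Real.pi) ∈ Ioo C.θlo D.uA} :=
      isOpen_Ioo.preimage (continuous_id.div_const _)
    filter_upwards [ho.mem_nhds (show 2 * Real.pi * v ∈ {t : ℝ | t / (2 * Real.pi) ∈ Ioo C.θlo D.uA} by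
      simp only [mem_setOf_eq]; rwa [mul_div_cancel_left₀ _ h2π.ne'])] with t ht
    show _ = E.c (C.B (D.cLo (g t)))
    rw [h.coe_Knew_circlePoint, P.per_eq_curve ⟨by linarith [ht.1], by linarith [ht.2, D.c₁_pos]⟩,
      P.curve_of_mem_lo ⟨ht.1, ht.2.le⟩]
    rfl
  refine ⟨2 * Real.pi * v, 1 / (2 * Real.pi) / D.c₁, by positivity, ?_, ?_⟩
  · apply Subtype.ext
    rw [hev.eq_of_nhds, coe_band]
    show E.c (C.B (D.cLo (g (2 * Real.pi * v)))) = _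
    rw [hgθ]
  · have hgd : HasDerivAt g (1 / (2 * Real.pi) / D.c₁) (2 * Real.pi * v) := by
      rw [hg]
      simpa using (((hasDerivAt_id (2 * Real.pi * v)).div_const (2 * Real.pi)).sub_const C.θlo).div_const D.c₁
    have hcLo : HasDerivAt D.cLo (deriv D.cLo 2⁻¹) (g (2 * Real.pi * v)) := by
      rw [hgθ]; exact ((D.cLo_spec.1.differentiable (by simp)) _).hasDerivAt
    have hB : HasFDerivAt C.B (fderiv ℝ C.B (D.cLo 2⁻¹)) ((D.cLo ∘ g) (2 * Real.pi * v)) := by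
      show HasFDerivAt C.B _ (D.cLo (g (2 * Real.pi * v)))
      rw [hgθ]; exact ((C.contDiff_B.differentiable (by simp)) _).hasFDerivAt
    have hc : HasFDerivAt E.c (fderiv ℝ E.c (C.B (D.cLo 2⁻¹))) ((C.B ∘ (D.cLo ∘ g)) (2 * Real.pi * v)) := by
      show HasFDerivAt E.c _ (C.B (D.cLo (g (2 * Real.pi * v))))
      rw [hgθ]; exact ((E.contDiff_c.differentiable (by simp)) _).hasFDerivAt
    have htot := hc.comp_hasDerivAt (2 * Real.pi * v)
      (hB.comp_hasDerivAt (2 * Real.pi * v) (hcLo.scomp (2 * Real.pi * v) hgd))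
    rw [hev.deriv_eq, htot.deriv, h.fderiv_coe_band, ContinuousLinearMap.comp_apply, map_smul, map_smul]

/-! ### The band-sum data -/

/-- **The band sum inside an end frame of a good tube is a band sum**: the `BandData` exhibiting
`Knew` as the band sum of the end knot `Kend` and the small knot `tiny` along the band `c ∘ B`,
with the arches of `BandSumDetour.lean` as planar arcs. [folklore] -/
def bandData : BandData Kend tiny Knew ∅ where
  band := h.band
  δ := C.δ
  δ_pos := C.δ_pos
  contMDiff := h.contMDiff_band
  injOn := h.injOn_band
  injective_mfderiv := fun _ hx ↦ h.injective_mfderiv_band hx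
  disjoint_avoid := disjoint_empty _
  preimage_left := h.preimage_left
  preimage_right := h.preimage_right
  range_diff := h.range_diff
  lowerArc := D.cLo
  upperArc := D.cUp
  contDiff_lowerArc := D.cLo_spec.1
  contDiff_upperArc := D.contDiff_cUp
  injOn_lowerArc := D.cLo_spec.2.2.2.2.2.2.1.injOn
  injOn_upperArc := D.injective_cUp.injOn
  deriv_lowerArc_ne_zero := fun t _ ↦ D.cLo_spec.2.2.2.2.2.2.2 t
  deriv_upperArc_ne_zero := fun t _ ↦ D.deriv_cUp_ne_zero t
  lowerArc_zero := D.cLo_zero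
  lowerArc_one := D.cLo_one
  upperArc_zero := D.cUp_zero
  upperArc_one := D.cUp_one
  lowerArc_mem := fun _ ht ↦ D.cLo_mem ht
  upperArc_mem := fun _ ht ↦ D.cUp_mem ht
  preimage_range := h.preimage_range
  orient_left := h.orient_left
  orient_right := h.orient_right
  orient_result := h.orient_result

/-- The band of the band-sum data is `cS ∘ B`. [folklore] -/
@[simp] theorem bandData_band : h.bandData.band = E.cS ∘ C.B := rfl

/-- The collar width of the band-sum data is `C.δ`. [folklore] -/
@[simp] theorem bandData_δ : h.bandData.δ = C.δ := rfl

/-- **The band sum inside an end frame is a band sum.** [folklore] -/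
theorem isBandSum : Knot.IsBandSum Kend tiny Knew ∅ := ⟨h.bandData⟩

end InTube

end KnotPiece

end BandFoliation

end Literature.Topology.FourManifolds
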